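import Literature.NumberTheory.Automorphic.ArchLocalStableOrbitalSumSingularTorus   -- ★ FILE B (F0P3a-p05 (g11)): the per-place pair (`mk_circleDiagonal_comp_eq_or`, `…_swap_ne`); brings ★ FILE A `KottwitzSignArchTorus` + ★ `ArchStableClassTorus`
import Literature.NumberTheory.Automorphic.ArchStableConjugacyLocalGlobal            -- ★ (g2) p838845: `isConj_arch_iff_forall_place`
import Literature.NumberTheory.Automorphic.ArchLocalStableConjDefinite                -- ★ `isConj_of_isStablyConj_archLocal_of_posDef` ∕ `…_negDef` (definite places: one class)
import HarnessLib

/-!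
# The (signed) stable orbital sum at a torus point of `G′_∞ = U(diag α)(L⁺ ⊗ ℝ)` as a sum over PER-PLACE TRANSVERSALS — the global class set at `t(z)` is the product of the
# per-place class sets (Rogawski 1990 §4.1 (4.1.1)–(4.1.2) p. 39, §8.2 Prop. 8.2.1 p. 118, §14.2 p. 232)

Topic `NumberTheory/Automorphic`; namespace `Literature.NumberTheory.Automorphic.UnitaryGroup`.  THEOREMS ONLY (no definition, no instance, no notation, no named fact, no `sorry`).
Cell `pub/hodgecm-mathlib`, ENGINE T1 (crux H413 = `stmt-HodgeConjecture-24833`); floor-1 preparation, count-neutral, under books rows #88 (ST-∞) ∕ #111 (S-d): road D2′∕ROAD-Sd, brick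
**«(J-sgn) SIGNED `Φ^st_∞` AT `γ₀`» FILE C (global, transversal form)** (F0P3a-p02 (g9)'s (o4); LEAD WORDS T8-34 (A) ∕ T8-38 (4), F0P3a-plan (g9); author F0P3a-p05 (g11)).  BY NAME over ★ FILE A
`KottwitzSignArchTorus` (`archStableOrbitalIntegral_classWeight_mul_archDiagTorus_eq_sum_of_conj`: the signed sum as a `Finset.sum` over the RANGE `ρ ↦ ⟦t(z∘ρ)⟧`, `ρ : W → S_N`, with repeats),
★ (g2) `isConj_arch_iff_forall_place` + ★ `archPiEquivCM_archDiagTorus` (conjugacy in `G′_∞` is conjugacy at every place), ★ FILE B `ArchLocalStableOrbitalSumSingularTorus` (the pair through the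
split-singular point at an indefinite place) and ★ `ArchLocalStableConjDefinite` (one class at a definite place).

WHAT IS PROVED.
* §1 (any `N`; `R : W → Finset (Perm (Fin N))` per-place sets of relabellings) **`mk_archDiagTorus_eq_mk_iff_forall`** (`⟦t z⟧ = ⟦t z′⟧ ↔ ∀ w, ⟦diag z_w⟧ = ⟦diag z′_w⟧` in `G_w`),
  **`image_univ_mk_archDiagTorus_comp_eq_image_piFinset`** (if every `R w` MEETS every class through `diag(z_w)` then the global list is the image of `Fintype.piFinset R`),
  **`injOn_mk_archDiagTorus_comp_piFinset`** (if every `R w` is injective on classes then so is `piFinset R`), and the TRANSVERSAL SUMS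
  **`archStableOrbitalIntegral_archDiagTorus_eq_sum_piFinset`** (`Φ^st_∞(t z, a) = Σ_{ρ ∈ Π_w R w} Φ(⟦t(z∘ρ)⟧, a)`) ∕ **`archStableOrbitalIntegral_classWeight_mul_archDiagTorus_eq_sum_piFinset`**
  (`Φ^st_∞(t z, (wt∘⟦·⟧)·a) = Σ_{ρ ∈ Π_w R w} wt(⟦t(z∘ρ)⟧)·Φ(⟦t(z∘ρ)⟧, a)` — at `wt := kottwitzSignArchWeight` each weight is ★ `kottwitzSignArchWeight_mk_archDiagTorus` = `∏_w e_w(diag(z_w ∘ ρ_w))`).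
* §2 THE PER-PLACE TRANSVERSALS: at an INDEFINITE place for `N = 3` and `z_w` two-valued (singular slot `k`, slots `ip`∕`im` of positive∕negative weight) the pair `{swap k ip, swap k im}` meets every
  class (`exists_mem_pair_mk_circleDiagonal_comp_eq`) and is injective on classes (`injOn_pair_mk_circleDiagonal_comp`) — ★ FILE B; at a DEFINITE place (any `N`, ANY `z`) `⟦diag(z ∘ ρ)⟧ = ⟦diag z⟧`
  for every `ρ` (`mk_circleDiagonal_comp_eq_mk_of_def`), so `{1}` is a transversal (`exists_mem_singleton_one_mk_circleDiagonal_comp_eq`, `injOn_singleton_one_mk_circleDiagonal_comp`);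
  and for `N = 3`: **`kottwitzSign_circleDiagonal_eq_neg_one_of_forall_mul_pos`** (the split-singular point has `e_w = −1` at a definite place), `stableOrbitalIntegralRel_circleDiagonal_eq_classOrbitalIntegral_of_def`
  (`Φ^st_w(diag z, a) = Φ(⟦diag z⟧, a)`), **`stableOrbitalIntegralRel_kottwitzSign_mul_circleDiagonal_eq_neg_of_def`** (the SIGNED sum there is `−Φ(⟦diag z⟧, a)`).
HONEST LABEL: HC_CM is proved only modulo the printed citations until rung 0 closes; this file is class book-keeping and pays nothing by itself.

## References
* [Rogawski1990] J. D. Rogawski, *Automorphic Representations of Unitary Groups in Three Variables*, Ann. of Math. Stud. 123 (1990): §4.1 (4.1.1)–(4.1.2) pp. 39–40, §3.8 Prop. 3.8.1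
  pp. 30–32, §8.2 p. 117, Prop. 8.2.1 p. 118, §8.3 p. 122, §14.2 p. 232 (definite places: stable conjugacy is conjugacy).
* [BorelJacquet1979] A. Borel, H. Jacquet, *Automorphic forms and automorphic representations*, PSPM 33.1 (1979), §4.1 (`G_∞ = ∏_w G_w`).
-/

set_option autoImplicit false

noncomputable section

open MeasureTheory Matrix Equiv Finset NumberField NumberField.InfinitePlace
open Literature.LinearAlgebra.Matrix Literature.NumberTheory.Rogawski1990
open scoped MatrixGroups ComplexConjugate ComplexOrder

namespace Literature.NumberTheory.Automorphic.UnitaryGroup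

/-! ## §1 The global class set at a torus point is the product of the per-place class sets; transversal sums -/

section Global

variable (L : Type) [Field L] [NumberField L] [IsCMField L] (N : ℕ) (α : Fin N → L)

/-- **`⟦t(z)⟧ = ⟦t(z′)⟧` IN `G′_∞` IFF `⟦diag(z_w)⟧ = ⟦diag(z′_w)⟧` IN `G_w` AT EVERY PLACE** (★ (g2) `isConj_arch_iff_forall_place` + ★ `archPiEquivCM_archDiagTorus`).
[cite: Rogawski1990, §4.1 (4.1.1) p. 39] [cite: BorelJacquet1979, §4.1] -/
theorem mk_archDiagTorus_eq_mk_iff_forall (z z' : {w : InfinitePlace L // IsComplex w} → Fin N → Circle) :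
    ConjClasses.mk (archDiagTorus L N α z) = ConjClasses.mk (archDiagTorus L N α z') ↔
      ∀ w : {w : InfinitePlace L // IsComplex w},
        ConjClasses.mk (⟨circleDiagonal N (z w), circleDiagonal_mem_archLocal_diagonal L N α w (z w)⟩ : archLocal L N (diagonal α) w) =
          ConjClasses.mk (⟨circleDiagonal N (z' w), circleDiagonal_mem_archLocal_diagonal L N α w (z' w)⟩ : archLocal L N (diagonal α) w) := by
  rw [ConjClasses.mk_eq_mk_iff_isConj, isConj_arch_iff_forall_place]
  simp only [archPiEquivCM_archDiagTorus, ConjClasses.mk_eq_mk_iff_isConj]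

open scoped Classical in
/-- **THE GLOBAL CLASS LIST IS THE IMAGE OF `Π_w R w`** whenever every `R w ⊆ S_N` meets every class through `diag(z_w)` in `G_w` (the range over ALL `ρ : W → S_N` of ★
`conjClasses_stable_archDiagTorus_eq_range_of_conj`, thinned to per-place representatives). [cite: Rogawski1990, §4.1 (4.1.1) p. 39; §8.2 Prop. 8.2.1 p. 118] -/
theorem image_univ_mk_archDiagTorus_comp_eq_image_piFinset (z : {w : InfinitePlace L // IsComplex w} → Fin N → Circle)
    (R : {w : InfinitePlace L // IsComplex w} → Finset (Perm (Fin N)))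
    (hcov : ∀ (w : {w : InfinitePlace L // IsComplex w}) (ρ : Perm (Fin N)), ∃ r ∈ R w,
      ConjClasses.mk (⟨circleDiagonal N (z w ∘ ρ), circleDiagonal_mem_archLocal_diagonal L N α w (z w ∘ ρ)⟩ : archLocal L N (diagonal α) w) =
        ConjClasses.mk (⟨circleDiagonal N (z w ∘ r), circleDiagonal_mem_archLocal_diagonal L N α w (z w ∘ r)⟩ : archLocal L N (diagonal α) w)) :
    Finset.univ.image (fun ρ : {w : InfinitePlace L // IsComplex w} → Perm (Fin N) => ConjClasses.mk (archDiagTorus L N α fun w => z w ∘ ρ w)) =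
      (Fintype.piFinset R).image (fun ρ : {w : InfinitePlace L // IsComplex w} → Perm (Fin N) => ConjClasses.mk (archDiagTorus L N α fun w => z w ∘ ρ w)) := by
  ext q
  simp only [Finset.mem_image, Finset.mem_univ, true_and, Fintype.mem_piFinset]
  constructor
  · rintro ⟨ρ, rfl⟩
    choose r hr hrr using fun w => hcov w (ρ w)
    exact ⟨r, hr, ((mk_archDiagTorus_eq_mk_iff_forall L N α (fun w => z w ∘ ρ w) (fun w => z w ∘ r w)).mpr hrr).symm⟩
  · rintro ⟨ρ, -, rfl⟩
    exact ⟨ρ, rfl⟩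

open scoped Classical in
/-- **INJECTIVITY ON `Π_w R w`** whenever every `R w` is injective on classes at `w`. [cite: Rogawski1990, §4.1 (4.1.1) p. 39] [cite: BorelJacquet1979, §4.1] -/
theorem injOn_mk_archDiagTorus_comp_piFinset (z : {w : InfinitePlace L // IsComplex w} → Fin N → Circle)
    (R : {w : InfinitePlace L // IsComplex w} → Finset (Perm (Fin N)))
    (hinj : ∀ w : {w : InfinitePlace L // IsComplex w}, Set.InjOn (fun r : Perm (Fin N) =>
      ConjClasses.mk (⟨circleDiagonal N (z w ∘ r), circleDiagonal_mem_archLocal_diagonal L N α w (z w ∘ r)⟩ : archLocal L N (diagonal α) w)) ↑(R w)) :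
    Set.InjOn (fun ρ : {w : InfinitePlace L // IsComplex w} → Perm (Fin N) => ConjClasses.mk (archDiagTorus L N α fun w => z w ∘ ρ w))
      ↑(Fintype.piFinset R) := by
  intro ρ hρ ρ' hρ' h
  rw [Finset.mem_coe, Fintype.mem_piFinset] at hρ hρ'
  funext w
  exact hinj w (Finset.mem_coe.mpr (hρ w)) (Finset.mem_coe.mpr (hρ' w)) ((mk_archDiagTorus_eq_mk_iff_forall L N α _ _).mp h w)

variable [∀ g : ↥(arch (↥(maximalRealSubfield L)) L (IsCMField.complexConj L) N (diagonal α)),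
    MeasurableSpace (↥(arch (↥(maximalRealSubfield L)) L (IsCMField.complexConj L) N (diagonal α)) ⧸
      Subgroup.centralizer ({g} : Set ↥(arch (↥(maximalRealSubfield L)) L (IsCMField.complexConj L) N (diagonal α))))]

open scoped Classical in
/-- **`Φ^st_∞(t z, a) = Σ_{ρ ∈ Π_w R w} Φ(⟦t(z∘ρ)⟧, a)` FOR PER-PLACE TRANSVERSALS `R`** (meeting every class: `hcov`; injective on classes: `hinj`) — ANY torus point, any family `m`, any `a`
(★ `archStableOrbitalIntegral_archDiagTorus_eq_sum_of_conj` + §1 + `Finset.sum_image`). [cite: Rogawski1990, §4.1 (4.1.1) p. 39; §8.2 Prop. 8.2.1 p. 118] -/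
theorem archStableOrbitalIntegral_archDiagTorus_eq_sum_piFinset (hα : ∀ i, α i ≠ 0) (hherm : ∀ i, (IsCMField.complexConj L (α i) : L) = α i)
    (z : {w : InfinitePlace L // IsComplex w} → Fin N → Circle) (R : {w : InfinitePlace L // IsComplex w} → Finset (Perm (Fin N)))
    (hcov : ∀ (w : {w : InfinitePlace L // IsComplex w}) (ρ : Perm (Fin N)), ∃ r ∈ R w,
      ConjClasses.mk (⟨circleDiagonal N (z w ∘ ρ), circleDiagonal_mem_archLocal_diagonal L N α w (z w ∘ ρ)⟩ : archLocal L N (diagonal α) w) =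
        ConjClasses.mk (⟨circleDiagonal N (z w ∘ r), circleDiagonal_mem_archLocal_diagonal L N α w (z w ∘ r)⟩ : archLocal L N (diagonal α) w))
    (hinj : ∀ w : {w : InfinitePlace L // IsComplex w}, Set.InjOn (fun r : Perm (Fin N) =>
      ConjClasses.mk (⟨circleDiagonal N (z w ∘ r), circleDiagonal_mem_archLocal_diagonal L N α w (z w ∘ r)⟩ : archLocal L N (diagonal α) w)) ↑(R w))
    (m : OrbitalMeasureFamily ↥(arch (↥(maximalRealSubfield L)) L (IsCMField.complexConj L) N (diagonal α)))
    (a : ↥(arch (↥(maximalRealSubfield L)) L (IsCMField.complexConj L) N (diagonal α)) → ℂ) :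
    archStableOrbitalIntegral L N (diagonal α) m a (archDiagTorus L N α z) =
      ∑ ρ ∈ Fintype.piFinset R, classOrbitalIntegral m a (ConjClasses.mk (archDiagTorus L N α fun w => z w ∘ ρ w)) := by
  classical
  rw [archStableOrbitalIntegral_archDiagTorus_eq_sum_of_conj L N α hα hherm z m a, image_univ_mk_archDiagTorus_comp_eq_image_piFinset L N α z R hcov,
    Finset.sum_image (injOn_mk_archDiagTorus_comp_piFinset L N α z R hinj)]

open scoped Classical in
/-- **THE SIGNED (CLASS-WEIGHTED) TRANSVERSAL SUM**: `Φ^st_∞(t z, (wt∘⟦·⟧)·a) = Σ_{ρ ∈ Π_w R w} wt(⟦t(z∘ρ)⟧) · Φ(⟦t(z∘ρ)⟧, a)` — at `wt := kottwitzSignArchWeight L N (diagonal α)` the weights are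
★ `kottwitzSignArchWeight_mk_archDiagTorus` = `∏_w e_w(diag(z_w ∘ ρ_w))` and this is print's SIGNED `Φ^st(γ, f_∞)` of (4.1.2) at the torus point, split-singular `γ₀` included.
[cite: Rogawski1990, §4.1 (4.1.2) pp. 39–40; §8.2 Prop. 8.2.1 p. 118] -/
theorem archStableOrbitalIntegral_classWeight_mul_archDiagTorus_eq_sum_piFinset (hα : ∀ i, α i ≠ 0) (hherm : ∀ i, (IsCMField.complexConj L (α i) : L) = α i)
    (z : {w : InfinitePlace L // IsComplex w} → Fin N → Circle) (R : {w : InfinitePlace L // IsComplex w} → Finset (Perm (Fin N)))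
    (hcov : ∀ (w : {w : InfinitePlace L // IsComplex w}) (ρ : Perm (Fin N)), ∃ r ∈ R w,
      ConjClasses.mk (⟨circleDiagonal N (z w ∘ ρ), circleDiagonal_mem_archLocal_diagonal L N α w (z w ∘ ρ)⟩ : archLocal L N (diagonal α) w) =
        ConjClasses.mk (⟨circleDiagonal N (z w ∘ r), circleDiagonal_mem_archLocal_diagonal L N α w (z w ∘ r)⟩ : archLocal L N (diagonal α) w))
    (hinj : ∀ w : {w : InfinitePlace L // IsComplex w}, Set.InjOn (fun r : Perm (Fin N) =>
      ConjClasses.mk (⟨circleDiagonal N (z w ∘ r), circleDiagonal_mem_archLocal_diagonal L N α w (z w ∘ r)⟩ : archLocal L N (diagonal α) w)) ↑(R w))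
    (wt : ConjClasses ↥(arch (↥(maximalRealSubfield L)) L (IsCMField.complexConj L) N (diagonal α)) → ℂ)
    (m : OrbitalMeasureFamily ↥(arch (↥(maximalRealSubfield L)) L (IsCMField.complexConj L) N (diagonal α)))
    (a : ↥(arch (↥(maximalRealSubfield L)) L (IsCMField.complexConj L) N (diagonal α)) → ℂ) :
    archStableOrbitalIntegral L N (diagonal α) m (fun x => wt (ConjClasses.mk x) * a x) (archDiagTorus L N α z) =
      ∑ ρ ∈ Fintype.piFinset R, wt (ConjClasses.mk (archDiagTorus L N α fun w => z w ∘ ρ w)) *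
        classOrbitalIntegral m a (ConjClasses.mk (archDiagTorus L N α fun w => z w ∘ ρ w)) := by
  classical
  rw [archStableOrbitalIntegral_classWeight_mul_archDiagTorus_eq_sum_of_conj L N α hα hherm z wt m a,
    image_univ_mk_archDiagTorus_comp_eq_image_piFinset L N α z R hcov, Finset.sum_image (injOn_mk_archDiagTorus_comp_piFinset L N α z R hinj)]

end Global

/-! ## §2 Per-place transversals: the pair at an indefinite place (`N = 3`), the singleton at a definite place (any `N`) -/

section Transversal

variable (L : Type) [Field L] (α : Fin 3 → L) (w : {w : InfinitePlace L // IsComplex w})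

/-- **INDEFINITE PLACE: THE PAIR MEETS EVERY CLASS** through the split-singular `diag(z)` (★ FILE B `mk_circleDiagonal_comp_eq_or`, docked at `w`).
[cite: Rogawski1990, §8.3 p. 122 (§8.2 Prop. 8.2.1 p. 118)] -/
theorem exists_mem_pair_mk_circleDiagonal_comp_eq (hα : ∀ i, α i ≠ 0) (hreal : ∀ i, (w.1.embedding (α i)).im = 0)
    {z : Fin 3 → Circle} {k : Fin 3} (hk : ∀ j, z j = z k ↔ j = k) (hzz : ∀ i j, i ≠ k → j ≠ k → z i = z j)
    {ip im : Fin 3} (hip : 0 < (w.1.embedding (α ip)).re) (him : (w.1.embedding (α im)).re < 0) (ρ : Perm (Fin 3)) :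
    ∃ r ∈ ({Equiv.swap k ip, Equiv.swap k im} : Finset (Perm (Fin 3))),
      ConjClasses.mk (⟨circleDiagonal 3 (z ∘ ρ), circleDiagonal_mem_archLocal_diagonal L 3 α w (z ∘ ρ)⟩ : archLocal L 3 (diagonal α) w) =
        ConjClasses.mk (⟨circleDiagonal 3 (z ∘ r), circleDiagonal_mem_archLocal_diagonal L 3 α w (z ∘ r)⟩ : archLocal L 3 (diagonal α) w) := by
  rcases mk_circleDiagonal_comp_eq_or (archLocal L 3 (diagonal α) w) (mem_archLocal_diagonal_iff_mem_unitaryGroupOfForm L 3 α w hreal)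
      (re_embedding_ne_zero L 3 α w hα hreal) hk hzz hip him ρ with h | h
  · exact ⟨Equiv.swap k ip, Finset.mem_insert_self _ _, h⟩
  · exact ⟨Equiv.swap k im, Finset.mem_insert_of_mem (Finset.mem_singleton_self _), h⟩

/-- **INDEFINITE PLACE: THE PAIR IS INJECTIVE ON CLASSES** (★ FILE B `mk_circleDiagonal_comp_swap_ne`). [cite: Rogawski1990, §8.3 p. 122 (§8.2 Prop. 8.2.1 p. 118)] -/
theorem injOn_pair_mk_circleDiagonal_comp (hreal : ∀ i, (w.1.embedding (α i)).im = 0)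
    {z : Fin 3 → Circle} {k : Fin 3} (hk : ∀ j, z j = z k ↔ j = k)
    {ip im : Fin 3} (hip : 0 < (w.1.embedding (α ip)).re) (him : (w.1.embedding (α im)).re < 0) :
    Set.InjOn (fun r : Perm (Fin 3) =>
        ConjClasses.mk (⟨circleDiagonal 3 (z ∘ r), circleDiagonal_mem_archLocal_diagonal L 3 α w (z ∘ r)⟩ : archLocal L 3 (diagonal α) w))
      ↑({Equiv.swap k ip, Equiv.swap k im} : Finset (Perm (Fin 3))) := by
  have hne := mk_circleDiagonal_comp_swap_ne (archLocal L 3 (diagonal α) w) (mem_archLocal_diagonal_iff_mem_unitaryGroupOfForm L 3 α w hreal) hk hip him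
  intro r hr r' hr' h
  simp only [Finset.coe_insert, Finset.coe_singleton, Set.mem_insert_iff, Set.mem_singleton_iff] at hr hr'
  rcases hr with rfl | rfl <;> rcases hr' with rfl | rfl
  · rfl
  · exact absurd h hne
  · exact absurd h.symm hne
  · rfl

end Transversal

section Definite

variable (L : Type) [Field L] (N : ℕ) (α : Fin N → L) (w : {w : InfinitePlace L // IsComplex w})

/-- **DEFINITE PLACE: ONE CLASS** — at a place where `σ_w(diag α)` is (positive or negative) definite, `⟦diag(z ∘ ρ)⟧ = ⟦diag z⟧` in `G_w` for EVERY relabelling `ρ` and ANY torus point `z`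
(stable conjugacy IS conjugacy in the compact `U(N)`: ★ `isConj_of_isStablyConj_archLocal_of_posDef`∕`…_negDef` + ★ `isStablyConj_circleDiagonal_iff_exists_perm_of_conj`). [cite: Rogawski1990, §14.2 p. 232] -/
theorem mk_circleDiagonal_comp_eq_mk_of_def (hdef : ((diagonal α).map w.1.embedding).PosDef ∨ (-(diagonal α).map w.1.embedding).PosDef)
    (z : Fin N → Circle) (ρ : Perm (Fin N)) :
    ConjClasses.mk (⟨circleDiagonal N (z ∘ ρ), circleDiagonal_mem_archLocal_diagonal L N α w (z ∘ ρ)⟩ : archLocal L N (diagonal α) w) =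
      ConjClasses.mk (⟨circleDiagonal N z, circleDiagonal_mem_archLocal_diagonal L N α w z⟩ : archLocal L N (diagonal α) w) := by
  have hst := (isStablyConj_circleDiagonal_iff_exists_perm_of_conj L N α w z (z ∘ ρ)).mpr ⟨ρ, rfl⟩
  refine (ConjClasses.mk_eq_mk_iff_isConj.mpr ?_).symm
  rcases hdef with h | h
  · exact isConj_of_isStablyConj_archLocal_of_posDef L N (diagonal α) w h _ _ hst
  · exact isConj_of_isStablyConj_archLocal_of_negDef L N (diagonal α) w h _ _ hst

/-- At a definite place `{1}` meets every class through `diag(z)`. [cite: Rogawski1990, §14.2 p. 232] -/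
theorem exists_mem_singleton_one_mk_circleDiagonal_comp_eq (hdef : ((diagonal α).map w.1.embedding).PosDef ∨ (-(diagonal α).map w.1.embedding).PosDef)
    (z : Fin N → Circle) (ρ : Perm (Fin N)) :
    ∃ r ∈ ({1} : Finset (Perm (Fin N))),
      ConjClasses.mk (⟨circleDiagonal N (z ∘ ρ), circleDiagonal_mem_archLocal_diagonal L N α w (z ∘ ρ)⟩ : archLocal L N (diagonal α) w) =
        ConjClasses.mk (⟨circleDiagonal N (z ∘ r), circleDiagonal_mem_archLocal_diagonal L N α w (z ∘ r)⟩ : archLocal L N (diagonal α) w) :=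
  ⟨1, Finset.mem_singleton_self _, by simpa only [Perm.coe_one, Function.comp_id] using mk_circleDiagonal_comp_eq_mk_of_def L N α w hdef z ρ⟩

omit [Field L] in
/-- A singleton is injective on classes (trivially). [folklore] -/
private theorem injOn_singleton_one' {β : Type*} (f : Perm (Fin N) → β) : Set.InjOn f ↑({1} : Finset (Perm (Fin N))) := by
  rw [Finset.coe_singleton]
  exact Set.injOn_singleton f 1

/-- At a definite place `{1}` is (trivially) injective on classes — the `hinj` input of §1 there. [cite: Rogawski1990, §14.2 p. 232] -/
theorem injOn_singleton_one_mk_circleDiagonal_comp (z : Fin N → Circle) :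
    Set.InjOn (fun r : Perm (Fin N) =>
        ConjClasses.mk (⟨circleDiagonal N (z ∘ r), circleDiagonal_mem_archLocal_diagonal L N α w (z ∘ r)⟩ : archLocal L N (diagonal α) w))
      ↑({1} : Finset (Perm (Fin N))) :=
  injOn_singleton_one' N _

end Definite

/-! ### The sign and the signed sum at a DEFINITE place (`N = 3`) -/

section DefiniteSign

variable (L : Type) [Field L] (α : Fin 3 → L) (w : {w : InfinitePlace L // IsComplex w})

/-- **AT A DEFINITE PLACE THE SPLIT-SINGULAR TORUS POINT HAS SIGN `−1`**: if all weights `re σ_w(α_i)` have the same sign (`G_w ≅ U(3)` compact) then for `z` two-valued (singular slot `k`)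
`e_w(diag z) = −1` — the `a`-plane is definite, the centraliser `U(2) × U(1)` is compact while its quasi-split inner form `U(1,1) × U(1)` is not («`q(U(2)) − q(U(1,1)) = 0 − 1`»).
[cite: Rogawski1990, §4.1 (4.1.2) p. 39; §14.2 p. 232] [cite: Kottwitz1983, §1] -/
theorem kottwitzSign_circleDiagonal_eq_neg_one_of_forall_mul_pos (hα : ∀ i, α i ≠ 0) (hreal : ∀ i, (w.1.embedding (α i)).im = 0)
    {z : Fin 3 → Circle} {k : Fin 3} (hk : ∀ j, z j = z k ↔ j = k) (hzz : ∀ i j, i ≠ k → j ≠ k → z i = z j)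
    (hsame : ∀ i j, 0 < (w.1.embedding (α i)).re * (w.1.embedding (α j)).re) :
    kottwitzSign (starRingEnd ℂ) ((diagonal α).map w.1.embedding) ((circleDiagonal 3 z : GL (Fin 3) ℂ) : Matrix (Fin 3) (Fin 3) ℂ) = -1 := by
  have hslots : ∀ k : Fin 3, ∃ i j : Fin 3, i ≠ k ∧ j ≠ k ∧ i ≠ j := by decide
  obtain ⟨i, j, hik, hjk, hij⟩ := hslots k
  have hne0 : ∀ i, w.1.embedding (α i) ≠ 0 := fun i => (map_ne_zero_iff _ (RingHom.injective _)).mpr (hα i)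
  have hs : ∀ m, ((z m : ℂ)) = (z k : ℂ) ↔ m = k := fun m => ⟨fun h => (hk m).mp (Circle.ext h), fun h => by rw [h]⟩
  have hdd : ∀ m m', m ≠ k → m' ≠ k → ((z m : ℂ)) = (z m' : ℂ) := fun m m' hm hm' => congrArg Subtype.val (hzz m m' hm hm')
  rw [coe_circleDiagonal, diagonal_map (map_zero _),
    kottwitzSign_conj_diagonal_eq_neg_one_iff_of_slots (d := fun m => (z m : ℂ)) (t := fun i => w.1.embedding (α i)) hs hdd hreal hne0 hik hjk hij,
    Complex.mul_re, hreal i, hreal j, mul_zero, sub_zero]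
  exact hsame i j

variable [∀ γ : archLocal L 3 (diagonal α) w, MeasurableSpace (archLocal L 3 (diagonal α) w ⧸ Subgroup.centralizer ({γ} : Set (archLocal L 3 (diagonal α) w)))]

open scoped Classical in
/-- **AT A DEFINITE PLACE: `Φ^st_w(diag z, a) = Φ(⟦diag z⟧, a)`** for ANY torus point (one class; the regular∕general statement for definite `H` is ★
`archLocal_stableOrbitalIntegralRel_eq_classOrbitalIntegral_of_posDef`; here in the torus currency via the one-point image). [cite: Rogawski1990, §14.2 p. 232] -/
theorem stableOrbitalIntegralRel_circleDiagonal_eq_classOrbitalIntegral_of_def (hα : ∀ i, α i ≠ 0) (hreal : ∀ i, (w.1.embedding (α i)).im = 0)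
    (hdef : ((diagonal α).map w.1.embedding).PosDef ∨ (-(diagonal α).map w.1.embedding).PosDef) (z : Fin 3 → Circle)
    (m : OrbitalMeasureFamily (archLocal L 3 (diagonal α) w)) (a : archLocal L 3 (diagonal α) w → ℂ) :
    stableOrbitalIntegralRel (G := archLocal L 3 (diagonal α) w) (IsStablyConj (starRingEnd ℂ) ((diagonal α).map w.1.embedding)) m a
        ⟨circleDiagonal 3 z, circleDiagonal_mem_archLocal_diagonal L 3 α w z⟩ =
      classOrbitalIntegral m a (ConjClasses.mk (⟨circleDiagonal 3 z, circleDiagonal_mem_archLocal_diagonal L 3 α w z⟩ : archLocal L 3 (diagonal α) w)) := by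
  have himg : Finset.univ.image (fun σ : Perm (Fin 3) =>
      ConjClasses.mk (⟨circleDiagonal 3 (z ∘ σ), circleDiagonal_mem_archLocal_diagonal L 3 α w (z ∘ σ)⟩ : archLocal L 3 (diagonal α) w)) =
      {ConjClasses.mk (⟨circleDiagonal 3 z, circleDiagonal_mem_archLocal_diagonal L 3 α w z⟩ : archLocal L 3 (diagonal α) w)} := by
    ext q
    simp only [Finset.mem_image, Finset.mem_univ, true_and, Finset.mem_singleton]
    constructor
    · rintro ⟨σ, rfl⟩
      exact mk_circleDiagonal_comp_eq_mk_of_def L 3 α w hdef z σ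
    · rintro rfl
      exact ⟨1, mk_circleDiagonal_comp_eq_mk_of_def L 3 α w hdef z 1⟩
  rw [stableOrbitalIntegralRel_circleDiagonal_eq_sum_of_conj L 3 α w hα hreal z m a, himg, Finset.sum_singleton]

open scoped Classical in
/-- **THE SIGNED SUM AT A DEFINITE PLACE IS `−Φ(⟦diag z⟧, a)`** at a split-singular torus point: one class, sign `−1` (`kottwitzSign_circleDiagonal_eq_neg_one_of_forall_mul_pos`) — the
compact-place factor of the (ST-∞) comparison. [cite: Rogawski1990, §4.1 (4.1.2) p. 39; §14.2 p. 232] -/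
theorem stableOrbitalIntegralRel_kottwitzSign_mul_circleDiagonal_eq_neg_of_def (hα : ∀ i, α i ≠ 0) (hreal : ∀ i, (w.1.embedding (α i)).im = 0)
    (hdef : ((diagonal α).map w.1.embedding).PosDef ∨ (-(diagonal α).map w.1.embedding).PosDef)
    (hsame : ∀ i j, 0 < (w.1.embedding (α i)).re * (w.1.embedding (α j)).re)
    {z : Fin 3 → Circle} {k : Fin 3} (hk : ∀ j, z j = z k ↔ j = k) (hzz : ∀ i j, i ≠ k → j ≠ k → z i = z j)
    (m : OrbitalMeasureFamily (archLocal L 3 (diagonal α) w)) (a : archLocal L 3 (diagonal α) w → ℂ) :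
    stableOrbitalIntegralRel (G := archLocal L 3 (diagonal α) w) (IsStablyConj (starRingEnd ℂ) ((diagonal α).map w.1.embedding)) m
        (fun x => (((kottwitzSign (starRingEnd ℂ) ((diagonal α).map w.1.embedding) ((x : GL (Fin 3) ℂ) : Matrix (Fin 3) (Fin 3) ℂ) : ℤˣ) : ℤ) : ℂ) * a x)
        ⟨circleDiagonal 3 z, circleDiagonal_mem_archLocal_diagonal L 3 α w z⟩ =
      -classOrbitalIntegral m a (ConjClasses.mk (⟨circleDiagonal 3 z, circleDiagonal_mem_archLocal_diagonal L 3 α w z⟩ : archLocal L 3 (diagonal α) w)) := by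
  have key := stableOrbitalIntegralRel_circleDiagonal_eq_classOrbitalIntegral_of_def L α w hα hreal hdef z m
    (fun x => (((kottwitzSign (starRingEnd ℂ) ((diagonal α).map w.1.embedding) ((x : GL (Fin 3) ℂ) : Matrix (Fin 3) (Fin 3) ℂ) : ℤˣ) : ℤ) : ℂ) * a x)
  rw [key]
  -- the weight on the function is the CLASS weight `q ↦ e_w(out q)`; factor it out of the class orbital integral (★ `classOrbitalIntegral_classWeight_mul`)
  have h2 := classOrbitalIntegral_classWeight_mul m
    (fun q : ConjClasses (archLocal L 3 (diagonal α) w) =>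
      (((kottwitzSign (starRingEnd ℂ) ((diagonal α).map w.1.embedding)
        (((Quotient.out q : archLocal L 3 (diagonal α) w) : GL (Fin 3) ℂ) : Matrix (Fin 3) (Fin 3) ℂ) : ℤˣ) : ℤ) : ℂ)) a
    (ConjClasses.mk (⟨circleDiagonal 3 z, circleDiagonal_mem_archLocal_diagonal L 3 α w z⟩ : archLocal L 3 (diagonal α) w))
  simp only [kottwitzSign_coe_out_mk_archLocal, kottwitzSign_circleDiagonal_eq_neg_one_of_forall_mul_pos L α w hα hreal hk hzz hsame,
    Units.val_neg, Units.val_one, Int.cast_neg, Int.cast_one, neg_one_mul] at h2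
  exact h2

end DefiniteSign

end Literature.NumberTheory.Automorphic.UnitaryGroup

end
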